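import Mathlib.Tactic.NormNum.Prime
import HarnessLib

/-!
# BirchSwinnertonDyer — rank ≥ 2 observatory: `Fact` instances for the primes `61 … 199`

HONEST FRAMING: per-curve certified theorems and census instruments; no claim on BSD in rank ≥ 2.

The kernel rank certificates reduce the listed generators modulo witness primes `q` and need
`[Fact q.Prime]`. Mathlib provides `2, 3`; `Rank2ObservatoryKernelPrimes.lean` provides `5 … 59`;
about `1.4 %` of the rank-3 census rows (mostly curves with a rational `2`-torsion point, whose
coset witnesses live only at primes where `Ẽ(𝔽_q)` has a point of order `4`) need a larger witness
prime. This file provides the instances for the `29` primes `61 ≤ q ≤ 199`, each by `norm_num`.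
[folklore]
-/

-- single-conjunct summit: `Summit.BirchSwinnertonDyer.BirchSwinnertonDyer.…` repeats the name by design
set_option linter.dupNamespace false

namespace Summit.BirchSwinnertonDyer.BirchSwinnertonDyer.Rank2Observatory

/-- `61` is prime. [folklore] -/
instance fact_prime_61 : Fact (Nat.Prime 61) := ⟨by norm_num⟩

/-- `67` is prime. [folklore] -/
instance fact_prime_67 : Fact (Nat.Prime 67) := ⟨by norm_num⟩

/-- `71` is prime. [folklore] -/
instance fact_prime_71 : Fact (Nat.Prime 71) := ⟨by norm_num⟩

/-- `73` is prime. [folklore] -/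
instance fact_prime_73 : Fact (Nat.Prime 73) := ⟨by norm_num⟩

/-- `79` is prime. [folklore] -/
instance fact_prime_79 : Fact (Nat.Prime 79) := ⟨by norm_num⟩

/-- `83` is prime. [folklore] -/
instance fact_prime_83 : Fact (Nat.Prime 83) := ⟨by norm_num⟩

/-- `89` is prime. [folklore] -/
instance fact_prime_89 : Fact (Nat.Prime 89) := ⟨by norm_num⟩

/-- `97` is prime. [folklore] -/
instance fact_prime_97 : Fact (Nat.Prime 97) := ⟨by norm_num⟩

/-- `101` is prime. [folklore] -/
instance fact_prime_101 : Fact (Nat.Prime 101) := ⟨by norm_num⟩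

/-- `103` is prime. [folklore] -/
instance fact_prime_103 : Fact (Nat.Prime 103) := ⟨by norm_num⟩

/-- `107` is prime. [folklore] -/
instance fact_prime_107 : Fact (Nat.Prime 107) := ⟨by norm_num⟩

/-- `109` is prime. [folklore] -/
instance fact_prime_109 : Fact (Nat.Prime 109) := ⟨by norm_num⟩

/-- `113` is prime. [folklore] -/
instance fact_prime_113 : Fact (Nat.Prime 113) := ⟨by norm_num⟩

/-- `127` is prime. [folklore] -/
instance fact_prime_127 : Fact (Nat.Prime 127) := ⟨by norm_num⟩

/-- `131` is prime. [folklore] -/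
instance fact_prime_131 : Fact (Nat.Prime 131) := ⟨by norm_num⟩

/-- `137` is prime. [folklore] -/
instance fact_prime_137 : Fact (Nat.Prime 137) := ⟨by norm_num⟩

/-- `139` is prime. [folklore] -/
instance fact_prime_139 : Fact (Nat.Prime 139) := ⟨by norm_num⟩

/-- `149` is prime. [folklore] -/
instance fact_prime_149 : Fact (Nat.Prime 149) := ⟨by norm_num⟩

/-- `151` is prime. [folklore] -/
instance fact_prime_151 : Fact (Nat.Prime 151) := ⟨by norm_num⟩

/-- `157` is prime. [folklore] -/
instance fact_prime_157 : Fact (Nat.Prime 157) := ⟨by norm_num⟩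

/-- `163` is prime. [folklore] -/
instance fact_prime_163 : Fact (Nat.Prime 163) := ⟨by norm_num⟩

/-- `167` is prime. [folklore] -/
instance fact_prime_167 : Fact (Nat.Prime 167) := ⟨by norm_num⟩

/-- `173` is prime. [folklore] -/
instance fact_prime_173 : Fact (Nat.Prime 173) := ⟨by norm_num⟩

/-- `179` is prime. [folklore] -/
instance fact_prime_179 : Fact (Nat.Prime 179) := ⟨by norm_num⟩

/-- `181` is prime. [folklore] -/
instance fact_prime_181 : Fact (Nat.Prime 181) := ⟨by norm_num⟩

/-- `191` is prime. [folklore] -/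
instance fact_prime_191 : Fact (Nat.Prime 191) := ⟨by norm_num⟩

/-- `193` is prime. [folklore] -/
instance fact_prime_193 : Fact (Nat.Prime 193) := ⟨by norm_num⟩

/-- `197` is prime. [folklore] -/
instance fact_prime_197 : Fact (Nat.Prime 197) := ⟨by norm_num⟩

/-- `199` is prime. [folklore] -/
instance fact_prime_199 : Fact (Nat.Prime 199) := ⟨by norm_num⟩

end Summit.BirchSwinnertonDyer.BirchSwinnertonDyer.Rank2Observatory
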